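import Summits.Ventures.PercRepro.Night2NonFatPlane
import Summits.Ventures.PercRepro.Night2NonFatStructure
import Summits.Ventures.PercRepro.Night2NonFatLineCell

/-!
# night-2: h21's cell `(2, 1)` for `V` a plane plus at most three points — no lossy basis pair (gen 37)

A lossy basis pair has at least three ACTIVE faces even with fat closures (`three_le_card_faceOk_of_loss_ne_zero'`: every face
requests at most `7/24`, and `2 · 7/24 < 11/18 ≤ capS Q`).  If all but at most three points of `V` lie in a set `π` of rank `≤ 3`,
a basis pair `(B, z)` has at most three basis points on `π`, so at least two off it, and `W = V ∖ Q′` has at most one point off `π`;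
`rk W ≥ 4` forces exactly one, `x₃`, with `W ∩ π` of rank `3`, so `cl W ⊇ π ∪ {x₃}`; an active face `w` has `W ∪ {w}` of rank `5`,
hence `w ∉ cl W`, hence `w ∉ π`: at most two active faces — no lossy pair at all (`not_lossy_of_plane_plus_three`).
**`localShadowHall_two_one_of_plane_plus_three`**: the cell's local Hall inequality, unconditionally on the fat closures.
Paper: proofs/NIGHT-2-g37.md §5.
-/

namespace PercRepro.Shadow

open PercRepro.ThmH PercRepro.PerFlat

variable {α : Type*} [DecidableEq α] {M : Matroid α} [M.Finite] {G : Finset α}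

/-- Every thin member requests at most `7/24` (it misses at least two points of `G`). -/
theorem req_le_seven_twentyfourths (hG : G ∈ flatsQ M (5 + 1)) (hd : (gr M \ G).card = 2) {B : Finset α}
    (hB : B ∈ thinMembers M 5 G) : req M 5 B ≤ 7 / 24 := by
  have hd' : (gr M \ G).card ≤ 5 := by omega
  rw [req_eq_of_thin hG hB, hd]
  have h2 := two_le_card_sdiff_of_not_lay0 hG hd' (mem_thinMembers.1 hB).1 (mem_thinMembers.1 hB).2
  have h2' : (2 : ℚ) ≤ ((G \ clF M B).card : ℚ) := by exact_mod_cast h2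
  unfold phiQ
  rw [div_le_div_iff₀ (by linarith) (by norm_num)]
  push_cast
  linarith

/-- **A lossy basis pair has at least three active faces** (with or without fat closures). -/
theorem three_le_card_faceOk_of_loss_ne_zero' (hG : G ∈ flatsQ M (5 + 1)) (hd : (gr M \ G).card = 2)
    (hk : kColoops M G = 1) {B : Finset α} (hB : B ∈ thinMembers M 5 G) {z : α} (hz : z ∈ G \ clF M B)
    (hl0 : loss M 5 G B z ≠ 0) :
    3 ≤ ((insert z B \ coloops M G).filter (fun w => faceOk M G (insert z B) w)).card := by
  have hQG : insert z B ⊆ G := Finset.insert_subset (Finset.mem_sdiff.1 hz).1 (subset_G_of_mem_thinMembers hB)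
  have hcap := capS_ge_eleven_eighteenths_two_one hd hk hQG
  have hlt := capS_lt_L1_of_loss_ne_zero hl0
  rw [L1_eq_sum_req_faces hG hd] at hlt
  have hsum : ∑ w ∈ (insert z B \ coloops M G).filter (fun w => faceOk M G (insert z B) w),
      req M 5 ((insert z B).erase w) ≤
      ∑ _w ∈ (insert z B \ coloops M G).filter (fun w => faceOk M G (insert z B) w), (7 / 24 : ℚ) := by
    apply Finset.sum_le_sum
    intro w hw
    rw [Finset.mem_filter] at hw
    exact req_le_seven_twentyfourths hG hd hw.2.1
  rw [Finset.sum_const, nsmul_eq_mul] at hsum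
  by_contra h
  rw [not_le] at h
  have h2 : (((insert z B \ coloops M G).filter (fun w => faceOk M G (insert z B) w)).card : ℚ) ≤ 2 := by
    exact_mod_cast (by omega : ((insert z B \ coloops M G).filter (fun w => faceOk M G (insert z B) w)).card ≤ 2)
  linarith

/-- An active face `w` of a basis pair is off the closure of `W`: `W ∪ {w} = G ∖ (Q.erase w)` has rank `≥ 5`. -/
theorem notMem_clF_sdiff_of_faceOk (hG : G ∈ flatsQ M (5 + 1)) (hd : (gr M \ G).card = 2)
    (hk : kColoops M G = 1) {B : Finset α} (hB : B ∈ thinMembers M 5 G) {z : α} (hz : z ∈ G \ clF M B)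
    {w : α} (hw : w ∈ insert z B \ coloops M G) (hok : faceOk M G (insert z B) w)
    (hW : rkN M (G \ insert z B) ≤ 4) : w ∉ clF M (G \ insert z B) := by
  have hd' : (gr M \ G).card ≤ 5 := by omega
  have hGg : G ⊆ gr M := (mem_flatsQ.1 hG).1
  have hQG : insert z B ⊆ G := Finset.insert_subset (Finset.mem_sdiff.1 hz).1 (subset_G_of_mem_thinMembers hB)
  have hwQ : w ∈ insert z B := (Finset.mem_sdiff.1 hw).1
  have h5 := five_le_rkN_sdiff_of_mem_Uq hd (mem_membersIn.1 (mem_thinMembers.1 hok.1).1).1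
  have hsub : G \ (insert z B).erase w ⊆ insert w (G \ insert z B) := by
    intro e he
    rw [Finset.mem_sdiff, Finset.mem_erase, not_and] at he
    rw [Finset.mem_insert, Finset.mem_sdiff]
    by_cases hew : e = w
    · exact Or.inl hew
    · exact Or.inr ⟨he.1, fun heQ => he.2 hew heQ⟩
  have h1 := rkN_mono (M := M) hsub
  intro hcl
  have h2 := rkN_insert_le_of_mem_clF (Finset.sdiff_subset.trans hGg) hcl
  have _ := hk
  omega

/-- **No lossy basis pair when `V` is a plane plus at most three points.** -/
theorem not_lossy_of_plane_plus_three (hG : G ∈ flatsQ M (5 + 1)) (hd : (gr M \ G).card = 2)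
    (hk : kColoops M G = 1) {π : Finset α} (hπ : π ⊆ G \ coloops M G) (hrπ : rkN M π ≤ 3)
    (h3 : ((G \ coloops M G) \ π).card ≤ 3) {B : Finset α} (hB : B ∈ thinMembers M 5 G) (hnP : ¬ bigP M G B)
    {z : α} (hz : z ∈ G \ clF M B) (hl0 : loss M 5 G B z ≠ 0) : False := by
  have hd' : (gr M \ G).card ≤ 5 := by omega
  have hGg : G ⊆ gr M := (mem_flatsQ.1 hG).1
  have hBG : B ⊆ G := subset_G_of_mem_thinMembers hB
  have hQG : insert z B ⊆ G := Finset.insert_subset (Finset.mem_sdiff.1 hz).1 hBG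
  have hKB : coloops M G ⊆ B := coloops_subset_of_mem_thinMembers hG hd' hB
  have h4 := card_sdiff_eq_four_of_not_bigP hG hd hk hB hnP
  have hzB : z ∉ B := fun h => (Finset.mem_sdiff.1 hz).2 (subset_clF_of_subset_gr (hBG.trans hGg) h)
  -- `Q′`: five independent points, at most three on `π`
  have hQ'card : (insert z B \ coloops M G).card = 5 := by
    have h1 : insert z B \ coloops M G = insert z (B \ coloops M G) := by
      ext e
      simp only [Finset.mem_sdiff, Finset.mem_insert]
      constructor
      · rintro ⟨h | h, hK⟩
        · exact Or.inl h
        · exact Or.inr ⟨h, hK⟩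
      · rintro (rfl | ⟨h, hK⟩)
        · exact ⟨Or.inl rfl, fun hK => hzB (hKB hK)⟩
        · exact ⟨Or.inr h, hK⟩
    rw [h1, Finset.card_insert_of_notMem (fun h => hzB (Finset.mem_sdiff.1 h).1), h4]
  have hQ'rk : rkN M (insert z B \ coloops M G) = (insert z B \ coloops M G).card :=
    rkN_eq_card_of_subset_of_rkN_eq_card (rkN_insert_eq_card hG hd hk hB hnP hz) Finset.sdiff_subset
  have hQπ : ((insert z B \ coloops M G) ∩ π).card ≤ 3 := by
    have h1 := rkN_eq_card_of_subset_of_rkN_eq_card hQ'rk (Finset.inter_subset_left : (insert z B \ coloops M G) ∩ π ⊆ _)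
    have h2 := rkN_mono (M := M) (Finset.inter_subset_right : (insert z B \ coloops M G) ∩ π ⊆ π)
    omega
  have hQoff : 2 ≤ ((insert z B \ coloops M G) \ π).card := by
    have := Finset.card_sdiff_add_card_inter (insert z B \ coloops M G) π
    omega
  -- `W` has at most one point off `π`
  have hWV : G \ insert z B ⊆ G \ coloops M G := by
    intro e he
    rw [Finset.mem_sdiff] at he
    exact Finset.mem_sdiff.2 ⟨he.1, fun hK => he.2 (Finset.mem_insert_of_mem (hKB hK))⟩
  have hdisj : Disjoint ((G \ insert z B) \ π) ((insert z B \ coloops M G) \ π) := by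
    rw [Finset.disjoint_left]
    intro e he1 he2
    exact (Finset.mem_sdiff.1 (Finset.mem_sdiff.1 he1).1).2 (Finset.sdiff_subset (Finset.mem_sdiff.1 he2).1)
  have hunion : ((G \ insert z B) \ π) ∪ ((insert z B \ coloops M G) \ π) ⊆ (G \ coloops M G) \ π := by
    apply Finset.union_subset
    · exact Finset.sdiff_subset_sdiff hWV (le_refl _)
    · exact Finset.sdiff_subset_sdiff (Finset.sdiff_subset_sdiff hQG (le_refl _)) (le_refl _)
  have hcardU := Finset.card_le_card hunion
  rw [Finset.card_union_of_disjoint hdisj] at hcardU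
  have hWoff : ((G \ insert z B) \ π).card ≤ 1 := by omega
  -- `rk W ≥ 4`, so `rk (W ∩ π) = 3` and `π ⊆ cl W`, while `rk W ≤ 4`
  have hrW := four_le_rkN_sdiff_insert hd hB z
  have hWsplit : G \ insert z B ⊆ ((G \ insert z B) ∩ π) ∪ ((G \ insert z B) \ π) := by
    intro e he
    by_cases heπ : e ∈ π
    · exact Finset.mem_union_left _ (Finset.mem_inter.2 ⟨he, heπ⟩)
    · exact Finset.mem_union_right _ (Finset.mem_sdiff.2 ⟨he, heπ⟩)
  have hr1 := rkN_mono (M := M) hWsplit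
  have hr2 := rkN_union_le_add_card (M := M) ((G \ insert z B) ∩ π) ((G \ insert z B) \ π)
  have hr3 := rkN_mono (M := M) (Finset.inter_subset_right : (G \ insert z B) ∩ π ⊆ π)
  have hrWπ : rkN M ((G \ insert z B) ∩ π) = 3 := by omega
  have hπg : π ⊆ gr M := hπ.trans (Finset.sdiff_subset.trans hGg)
  have hπcl : π ⊆ clF M ((G \ insert z B) ∩ π) := by
    have heq : clF M ((G \ insert z B) ∩ π) = clF M π := by
      apply clF_eq_clF_of_subset_clF_of_rkN_le hπg
      · exact (Finset.inter_subset_right : (G \ insert z B) ∩ π ⊆ π).trans (subset_clF_of_subset_gr hπg)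
      · omega
    rw [heq]
    exact subset_clF_of_subset_gr hπg
  have hπW : π ⊆ clF M (G \ insert z B) := hπcl.trans (clF_mono Finset.inter_subset_left)
  have hW4 : rkN M (G \ insert z B) ≤ 4 := by
    have := rkN_union_le_add_card (M := M) ((G \ insert z B) ∩ π) ((G \ insert z B) \ π)
    omega
  -- the active faces lie off `cl W ⊇ π`: at most two
  have hact : (insert z B \ coloops M G).filter (fun w => faceOk M G (insert z B) w) ⊆
      (insert z B \ coloops M G) \ π := by
    intro w hw
    rw [Finset.mem_filter] at hw
    rw [Finset.mem_sdiff]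
    refine ⟨hw.1, fun hwπ => ?_⟩
    exact notMem_clF_sdiff_of_faceOk hG hd hk hB hz hw.1 hw.2 hW4 (hπW hwπ)
  have h3a := three_le_card_faceOk_of_loss_ne_zero' hG hd hk hB hz hl0
  have h2 := Finset.card_le_card hact
  have hQoff' : ((insert z B \ coloops M G) \ π).card ≤ 2 := by omega
  omega

/-- **h21's cell `(2, 1)` for `V` a plane plus at most three points.** -/
theorem localShadowHall_two_one_of_plane_plus_three (hG : G ∈ flatsQ M (5 + 1)) (hd : (gr M \ G).card = 2)
    (hk : kColoops M G = 1) (hs : ∀ e ∈ gr M, ∀ f ∈ gr M, e ≠ f → rkN M {e, f} = 2)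
    (hl : ∀ e ∈ gr M, M.Indep {e}) {π : Finset α} (hπ : π ⊆ G \ coloops M G) (hrπ : rkN M π ≤ 3)
    (h3 : ((G \ coloops M G) \ π).card ≤ 3) : LocalShadowHall M 5 G := by
  rcases Nat.lt_or_ge (fatClosures M 5 G 2).card 2 with hlt | hge
  · apply localShadowHall_of_gt2_of_basis_fair hG hd hk hs hl (by omega)
    intro B hB hnP z hz
    by_cases hl0 : loss M 5 G B z = 0
    · rw [hl0]
      have hd' : (gr M \ G).card ≤ 5 := by omega
      have h1 : 0 ≤ rhoL M 5 G B z := by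
        unfold rhoL
        rw [hl0]
        simp
      have h2 : 0 ≤ lossIncomeH M 5 G (bigP M G) (dshGT2 M 5 G) B z :=
        lossIncomeH_nonneg hG hd' (column_side_gt2 hG hd hk hs hl (by omega)) B z
      positivity
    · exact (not_lossy_of_plane_plus_three hG hd hk hπ hrπ h3 hB hnP hz hl0).elim
  · exact localShadowHall_two_one_five_fatClosures_free hG hd hk hs hl hge

end PercRepro.Shadow
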